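import Mathlib
import Summits.NavierStokesRegularity.NavierStokesRegularity.Theorems.CorkscrewDynamoCorkscrewProfileCorotatingFrame
import Literature.Analysis.FluidPDE.AxisymmetricVorticityTransport
import HarnessLib

/-!
# The co-rotating profile equation of an `s`-dependent rotating wave of Leray's backward system
  (pub-ns-dss E33-CL STEP 2, dictionary piece (S2); route `DssFarFieldSlaving`, crux
  `BlowupTypeIDssProfile`, stmt-NavierStokesRegularity-0155 — SUPPORT; cell pub-ns-dss, typer seat g4,
  2026-08-23)

HONEST FRAMING. Pure calculus (chain rule for a moving rotation, rotation covariance of `D`, `(U·∇)U`,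
`∇`, `Δ`, `div`); nothing here bears on Navier–Stokes regularity. If `(W, Q)` is a classical solution
of Leray's backward system `∂ₛW + ½W + ½DW[y] + DW[W] + ∇Q = ΔW`, `div W = 0` on `ℝ × ℝ³`
(`IsBackwardLeraySolutionOn univ 1 W Q`) and `W(s, y) = R_{αs} U(R_{−αs} y, s)` is the rotating wave
of a jointly smooth `s`-DEPENDENT profile `U` (`R_θ = rotZ θ`, `J = rotGen`; this is
`lerayOrbit (pvAnsatz α U)` by `PineauVicol2026.lerayOrbit_pvAnsatz`), then `U` and the co-rotated
pressure `P(z, s) = Q(s, R_{αs} z)` solve Pineau–Vicol's rotated profile system (1.14a) slice by slice,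
`∂ₛU + α(JU − DU[Jz]) + ½U + ½DU[z] − ΔU + DU[U] + ∇P = 0`, and the slices `U(·, s)` are divergence
free — exactly the binders `heq`, `hdiv` of the tree's E33 profile lemmas
(`GaussianHeadPressure.signCoherent_rdssProfile_trivial_polyPressure` and its variants). The steady
case (`U` independent of `s`, at `s = 0`) is the tree's `CorkscrewProfile.Birth.stub_rotatingWaveProfileEq`,
whose calculus (`hasDerivAt_rotZ_comp`, `rotZ_neg_smul_add_smul_rotGen`) is reused; the converse
steady direction is `CorkscrewProfile.Birth.stub_corotatingFrame`. [this file; folklore; typer STEP-2 scoping (S2)]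
-/

noncomputable section

set_option linter.dupNamespace false

namespace Summit.NavierStokesRegularity.NavierStokesRegularity.Theorems.GaussianHeadPressure

open Set Function Filter
open scoped Laplacian ContDiff Topology
open Literature.Analysis Literature.Analysis.FluidPDE
open Summit.NavierStokesRegularity.NavierStokesRegularity.Theorems.CorkscrewProfile.Birth
  (hasDerivAt_rotZ_comp rotZ_neg_smul_add_smul_rotGen)

/-- The slice of the rotating wave is the conjugate of the profile slice by the rotation `R_{αs}`:
`W(s, ·) = R_{αs} ∘ U(·, s) ∘ R_{−αs}`. [folklore] -/
theorem rotatingWave_slice_eq_conj {α : ℝ}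
    {U : EuclideanSpace ℝ (Fin 3) → ℝ → EuclideanSpace ℝ (Fin 3)}
    {W : ℝ → EuclideanSpace ℝ (Fin 3) → EuclideanSpace ℝ (Fin 3)}
    (hW : ∀ s y, W s y = rotZ (α * s) (U (rotZ (-(α * s)) y) s)) (s : ℝ) :
    W s = fun x => rotZLIE (α * s) ((fun z => U z s) ((rotZLIE (α * s)).symm x)) := by
  funext x
  rw [hW s x, rotZLIE_symm_apply, rotZLIE_apply]

/-- The profile slice is the conjugate of the wave slice by the inverse rotation:
`U(·, s) = R_{−αs} ∘ W(s, ·) ∘ R_{αs}`. [folklore] -/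
theorem corotatingProfile_slice_eq_conj {α : ℝ}
    {U : EuclideanSpace ℝ (Fin 3) → ℝ → EuclideanSpace ℝ (Fin 3)}
    {W : ℝ → EuclideanSpace ℝ (Fin 3) → EuclideanSpace ℝ (Fin 3)}
    (hW : ∀ s y, W s y = rotZ (α * s) (U (rotZ (-(α * s)) y) s)) (s : ℝ) :
    (fun z => U z s) = fun z => rotZLIE (-(α * s)) (W s ((rotZLIE (-(α * s))).symm z)) := by
  funext z
  rw [rotZLIE_symm_apply, rotZLIE_apply, hW, ← rotZ_add, ← rotZ_add, neg_neg, neg_add_cancel,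
    rotZ_zero, rotZ_zero]

/-- **The slices of the co-rotating profile are divergence free** when the wave's are. [folklore] -/
theorem corotatingProfile_isDivFree {α : ℝ}
    {U : EuclideanSpace ℝ (Fin 3) → ℝ → EuclideanSpace ℝ (Fin 3)}
    {W : ℝ → EuclideanSpace ℝ (Fin 3) → EuclideanSpace ℝ (Fin 3)}
    (hW : ∀ s y, W s y = rotZ (α * s) (U (rotZ (-(α * s)) y) s)) {s : ℝ}
    (hdiv : VectorCalculus.IsDivFree (W s)) : VectorCalculus.IsDivFree fun z => U z s := by
  rw [corotatingProfile_slice_eq_conj hW s]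
  exact hdiv.conj_linearIsometryEquiv _

/-- **The time derivative of the rotating wave**: for a jointly smooth profile,
`∂ₛ[R_{ασ} U(R_{−ασ} x, σ)](s) = R_{αs} (α (J U(y,s) − D_yU(y,s)[J y]) + ∂ₛU(y, s))` at `x = R_{αs} y`.
[folklore] -/
theorem deriv_rotatingWave {α : ℝ}
    {U : EuclideanSpace ℝ (Fin 3) → ℝ → EuclideanSpace ℝ (Fin 3)}
    (hUj : ContDiff ℝ ∞ (fun q : EuclideanSpace ℝ (Fin 3) × ℝ => U q.1 q.2)) (s : ℝ)
    (y : EuclideanSpace ℝ (Fin 3)) :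
    deriv (fun σ => rotZ (α * σ) (U (rotZ (-(α * σ)) (rotZ (α * s) y)) σ)) s =
      rotZ (α * s) (α • (rotGen (U y s) - fderiv ℝ (fun z => U z s) y (rotGen y)) +
        fderiv ℝ (fun σ => U y σ) s 1) := by
  set x : EuclideanSpace ℝ (Fin 3) := rotZ (α * s) y with hx
  have hyx : rotZ (-(α * s)) x = y := by
    rw [hx, ← rotZ_add, neg_add_cancel, rotZ_zero]
  -- the joint derivative of the uncurried profile at `(y, s)`
  have hUd : HasFDerivAt (fun q : EuclideanSpace ℝ (Fin 3) × ℝ => U q.1 q.2)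
      (fderiv ℝ (fun q : EuclideanSpace ℝ (Fin 3) × ℝ => U q.1 q.2) (y, s)) (y, s) :=
    ((hUj.differentiable (by simp)) _).hasFDerivAt
  set L := fderiv ℝ (fun q : EuclideanSpace ℝ (Fin 3) × ℝ => U q.1 q.2) (y, s) with hL
  have hsl : HasFDerivAt (fun z => U z s) (L.comp (ContinuousLinearMap.inl ℝ _ ℝ)) y := by
    have h : HasFDerivAt ((fun q : EuclideanSpace ℝ (Fin 3) × ℝ => U q.1 q.2) ∘
        fun z : EuclideanSpace ℝ (Fin 3) => (z, s))
        (L.comp (ContinuousLinearMap.inl ℝ (EuclideanSpace ℝ (Fin 3)) ℝ)) y :=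
      HasFDerivAt.comp y hUd (hasFDerivAt_prodMk_left (𝕜 := ℝ) y s)
    exact h
  have htl : HasFDerivAt (fun σ => U y σ) (L.comp (ContinuousLinearMap.inr ℝ _ ℝ)) s := by
    have h : HasFDerivAt ((fun q : EuclideanSpace ℝ (Fin 3) × ℝ => U q.1 q.2) ∘
        fun σ : ℝ => (y, σ))
        (L.comp (ContinuousLinearMap.inr ℝ (EuclideanSpace ℝ (Fin 3)) ℝ)) s :=
      HasFDerivAt.comp s hUd (hasFDerivAt_prodMk_right (𝕜 := ℝ) y s)
    exact h
  have hsl' : ∀ v, fderiv ℝ (fun z => U z s) y v = L (v, 0) := fun v => by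
    rw [hsl.fderiv, ContinuousLinearMap.comp_apply, ContinuousLinearMap.inl_apply]
  have htl' : fderiv ℝ (fun σ => U y σ) s 1 = L (0, 1) := by
    rw [htl.fderiv, ContinuousLinearMap.comp_apply, ContinuousLinearMap.inr_apply]
  -- the moving argument `σ ↦ R_{−ασ} x`
  have hθ₁ : HasDerivAt (fun t : ℝ => α * t) α s := by
    simpa using (hasDerivAt_id s).const_mul α
  have hθ₂ : HasDerivAt (fun t : ℝ => -(α * t)) (-α) s := hθ₁.neg
  have hzd : HasDerivAt (fun t => rotZ (-(α * t)) x) ((-α) • rotGen y) s := by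
    have h := hasDerivAt_rotZ_comp hθ₂ (hasDerivAt_const s x)
    refine h.congr_deriv ?_
    have h0 : rotZ (-(α * s)) (0 : EuclideanSpace ℝ (Fin 3)) = 0 := by
      ext i
      fin_cases i <;> simp
    rw [h0, zero_add, hyx]
  have hγ : HasDerivAt (fun t => (rotZ (-(α * t)) x, t)) ((-α) • rotGen y, (1 : ℝ)) s :=
    hzd.prodMk (hasDerivAt_id s)
  have hwd : HasDerivAt (fun t => U (rotZ (-(α * t)) x) t) (L ((-α) • rotGen y, 1)) s := by
    have h := hUd.comp_hasDerivAt_of_eq s hγ (by rw [hyx])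
    exact h
  have hsplit : L ((-α) • rotGen y, 1) =
      (-α) • fderiv ℝ (fun z => U z s) y (rotGen y) + fderiv ℝ (fun σ => U y σ) s 1 := by
    rw [← ContinuousLinearMap.map_smul, hsl', htl', ← map_add, Prod.mk_add_mk, add_zero, zero_add]
  have hUd' := hasDerivAt_rotZ_comp hθ₁ hwd
  rw [hUd'.deriv, hsplit, hyx]
  have hlin : ∀ a b : EuclideanSpace ℝ (Fin 3),
      rotZ (α * s) (a + b) = rotZ (α * s) a + rotZ (α * s) b := fun a b => by
    rw [← rotZL_apply, map_add, rotZL_apply, rotZL_apply]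
  rw [hlin, add_right_comm, rotZ_neg_smul_add_smul_rotGen, ← hlin]

/-- **The co-rotating profile equation** (Pineau–Vicol (1.14a), slice by slice): if `(W, Q)` solves
Leray's backward system classically on `ℝ × ℝ³` and `W(s, y) = R_{αs} U(R_{−αs} y, s)` for a jointly
smooth profile `U`, then with the co-rotated pressure `P(z, s) = Q(s, R_{αs} z)`,
`∂ₛU + α(JU − DU[Jz]) + ½U + ½DU[z] − ΔU + DU[U] + ∇P = 0` at every `(s, z)` — the binder `heq` of
the tree's E33 profile lemmas (`GaussianHeadPressure.signCoherent_rdssProfile_trivial_polyPressure`).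
[folklore] -/
theorem corotatingProfile_momentum {α : ℝ}
    {U : EuclideanSpace ℝ (Fin 3) → ℝ → EuclideanSpace ℝ (Fin 3)}
    {W : ℝ → EuclideanSpace ℝ (Fin 3) → EuclideanSpace ℝ (Fin 3)}
    {Q : ℝ → EuclideanSpace ℝ (Fin 3) → ℝ}
    (hL : IsBackwardLeraySolutionOn univ 1 W Q)
    (hUj : ContDiff ℝ ∞ (fun q : EuclideanSpace ℝ (Fin 3) × ℝ => U q.1 q.2))
    (hW : ∀ s y, W s y = rotZ (α * s) (U (rotZ (-(α * s)) y) s)) (s : ℝ)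
    (y : EuclideanSpace ℝ (Fin 3)) :
    fderiv ℝ (fun σ => U y σ) s 1 +
        α • (rotGen (U y s) - fderiv ℝ (fun z => U z s) y (rotGen y)) +
        (1 / 2 : ℝ) • U y s + (1 / 2 : ℝ) • fderiv ℝ (fun z => U z s) y y -
        (Δ (fun z => U z s)) y + convect (fun z => U z s) (fun z => U z s) y +
        gradient (fun z => Q s (rotZ (α * s) z)) y = 0 := by
  set R : EuclideanSpace ℝ (Fin 3) ≃ₗᵢ[ℝ] EuclideanSpace ℝ (Fin 3) := rotZLIE (α * s) with hR
  set x : EuclideanSpace ℝ (Fin 3) := R y with hx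
  have hyx : R.symm x = y := R.symm_apply_apply y
  have hWs : W s = fun x' => R ((fun z => U z s) (R.symm x')) := rotatingWave_slice_eq_conj hW s
  have hQs : Q s = fun x' => (fun z => Q s (rotZ (α * s) z)) (R.symm x') := by
    funext x'
    show Q s x' = Q s (rotZ (α * s) ((rotZLIE (α * s)).symm x'))
    rw [rotZLIE_symm_apply, ← rotZ_add, add_neg_cancel, rotZ_zero]
  -- Leray's momentum equation of the wave at `(s, x)`, `x = R y`
  have key := hL.momentum_leray (mem_univ s) x
  -- the time derivative
  have htd : timeDerivWithin univ W s x =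
      R (α • (rotGen (U y s) - fderiv ℝ (fun z => U z s) y (rotGen y)) +
        fderiv ℝ (fun σ => U y σ) s 1) := by
    rw [timeDerivWithin_eq_deriv isOpen_univ (mem_univ s)]
    have e : (fun σ => W σ x) = fun σ => rotZ (α * σ) (U (rotZ (-(α * σ)) (rotZ (α * s) y)) σ) :=
      funext fun σ => by rw [hW σ x]; rfl
    rw [e, deriv_rotatingWave hUj s y]
    rfl
  -- the spatial terms
  have hval : W s x = R (U y s) := by
    rw [hWs]
    simp only [hyx]
  have hfd : fderiv ℝ (W s) x x = R (fderiv ℝ (fun z => U z s) y y) := by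
    rw [hWs, fderiv_conj_linearIsometryEquiv R (fun z => U z s) x, hyx]
    simp only [ContinuousLinearMap.coe_comp, Function.comp_apply, ContinuousLinearEquiv.coe_coe,
      LinearIsometryEquiv.coe_toContinuousLinearEquiv, hyx]
  have hconv : convect (W s) (W s) x = R (convect (fun z => U z s) (fun z => U z s) y) := by
    rw [hWs, convect_conj_linearIsometryEquiv R (fun z => U z s) (fun z => U z s) x, hyx]
  have hlap : (Δ (W s)) x = R ((Δ (fun z => U z s)) y) := by
    rw [hWs, laplacian_conj_linearIsometryEquiv R (fun z => U z s) x, hyx]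
  have hgrad : gradient (Q s) x = R (gradient (fun z => Q s (rotZ (α * s) z)) y) := by
    have h := gradient_comp_linearIsometryEquiv_symm R (fun z => Q s (rotZ (α * s) z)) x
    rw [hyx, ← hQs] at h
    exact h
  rw [htd, hval, hfd, hconv, hgrad, hlap, one_smul] at key
  have key' : R (α • (rotGen (U y s) - fderiv ℝ (fun z => U z s) y (rotGen y)) +
      fderiv ℝ (fun σ => U y σ) s 1 + (1 / 2 : ℝ) • U y s +
      (1 / 2 : ℝ) • fderiv ℝ (fun z => U z s) y y + convect (fun z => U z s) (fun z => U z s) y +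
      gradient (fun z => Q s (rotZ (α * s) z)) y) = R ((Δ fun z => U z s) y) := by
    simpa only [map_add, LinearIsometryEquiv.map_smul] using key
  have h := R.injective key'
  rw [← h]
  abel

end Summit.NavierStokesRegularity.NavierStokesRegularity.Theorems.GaussianHeadPressure
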